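import Literature.AlgebraicGeometry.Frobenioids.IrreducibleMorphisms
import Literature.AlgebraicGeometry.Frobenioids.FrobeniusConjugates
import HarnessLib

/-!
# Frobenioids I, Proposition 1.14 (Irreducible Morphisms), part (v): `Div`-identity prime-Frobenius endomorphisms

Mochizuki, *The geometry of Frobenioids I: the general theory*, Kyushu J. Math. **62** (2008)
293–400, §1, Proposition 1.14 (v) and its proof, kurims text pp. 41, 43
[cite: MochizukiFrdI2008, Prop. 1.14]. Standing data: `Φ` a divisorial monoid on a connected,
totally epimorphic category `D`; `C → F_Φ` a Frobenioid (`hF`) of isotropic type (`hist`).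

> "(v) Suppose further that `Φ` is non-dilating, and that `φ` is a non-pre-step irreducible
> endomorphism of a non-group-like object `A ∈ Ob(C)`. Then `φ` is a `Div`-identity
> prime-Frobenius endomorphism if and only if the following condition holds: For every step
> `α : A → B`, there exists a non-pre-step irreducible morphism `ψ : B → B′` and a step
> `β : B → B′` such that `ψ ∘ α = β ∘ α ∘ φ`."

PROVED along the printed proof (p. 43). Necessity: `ψ` a prime-Frobenius morphism out of `B`
with `deg_Fr(ψ) = deg_Fr(φ)` (Def. 1.3 (ii)), the Frobenius conjugate `α′` of `α` (Prop. 1.10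
(i), with `Div(α′) = deg_Fr(φ) · Div(α)` as `φ` is a `Div`-identity) and the step `β` with
`β ∘ α = α′` from the equivalence `^A(C^coa-pre) ⥲ Order(Φ(A))` of Def. 1.3 (iii)(d). Sufficiency:
by (i) `φ` is prime-Frobenius or a pull-back morphism; steps `α` with prescribed `Div(α) = x` exist
(Def. 1.3 (iii)(d)); comparing zero divisors in `ψ ∘ α = β ∘ α ∘ φ` (Remark 1.1.1, with (iv) to
identify the type of `ψ`) gives `φ^*(x) ≤ x` for all `x` in the pull-back case (so `φ^* = id` by
non-dilation, forcing `Div(β) = 0` — a contradiction) and `φ^*(x) ≼ x` in the prime-Frobenius case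
(so `φ^* = id`, i.e. `φ` is a `Div`-identity). The printed standing hypothesis "`D` of
FSMFF-type" is not used. (The statement is proved outright as a theorem; no separate named statement of
(v) exists in the tree — the draft `IrreducibleMorphismsCriteria.lean` mentioned in earlier versions of this
docstring was withdrawn unfiled, referee finding I4-F1.)

Renderings (recorded for the referee). Composition is diagrammatic (`α ≫ ψ = φ ≫ α ≫ β` is the
text's `ψ ∘ α = β ∘ α ∘ φ`); "`Φ` non-dilating" is `IsNonDilatingOn Φ` (Def. 1.1 (ii));
"`Div`-identity" is `IsDivIdentity` (`φ^* = id`). No statement of the paper is strengthened.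
-/

namespace Literature.AlgebraicGeometry.Frobenioids

open CategoryTheory Opposite

universe w v v' u u'

namespace PreFrobenioid

variable {D : Type u} [Category.{v} D] {Φ : Dᵒᵖ ⥤ CommMonCat.{w}}
  {C : Type u'} [Category.{v'} C] (F : C ⥤ ElemFrobenioid Φ)

/-! ### Preliminaries: non-dilation for a sharp monoid; steps with prescribed zero divisor -/

/-- In a sharp monoid `Associates.mk` is injective. [folklore] -/
private theorem mk_injective_of_isSharp {M : Type w} [CommMonoid M] (hM : IsSharp M) :
    Function.Injective (Associates.mk : M → Associates M) := by
  intro a b h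
  obtain ⟨u, hu⟩ := Associates.mk_eq_mk_iff_associated.mp h
  rw [hM.eq_one_of_isUnit _ u.isUnit, mul_one] at hu
  exact hu

/-- Non-dilation (Def. 1.1 (i)/(ii)) for the pull-back along an endomorphism of the base, in the
form used on p. 43: if `φ_D^*(x) ≼ x` for every `x ∈ Φ(A_D)` then `φ_D^* = id` (`Φ(A_D)` being
sharp, `Φ(A_D)^{char} = Φ(A_D)`). [cite: MochizukiFrdI2008, Prop. 1.14(v) p.43] -/
theorem pull_eq_id_of_precsim (hP : IsPreFrobenioid Φ F) (hnd : IsNonDilatingOn Φ) {A : C}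
    (f : baseObj F A ⟶ baseObj F A) (h : ∀ x, pull Φ f x ≼ x) :
    pull Φ f = MonoidHom.id _ := by
  have hchar := hnd (baseObj F A) f (fun a _ => by
    obtain ⟨x, rfl⟩ := Associates.mk_surjective a
    rw [associatesMap_mk]
    exact (h x).map Associates.mkMonoidHom)
  ext x
  have h1 := congrArg (fun g => g (Associates.mk x)) hchar
  simp only [associatesMap_mk, MonoidHom.id_apply] at h1
  exact mk_injective_of_isSharp (hP.isDivisorial (baseObj F A)).isSharp h1

/-- In a Frobenioid of isotropic type, a co-angular pre-step is an isomorphism iff it is an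
isometry. [cite: MochizukiFrdI2008, Prop. 1.4(iii) p.25] -/
theorem isIso_iff_isIsometry_of_isPreStep (hP : IsPreFrobenioid Φ F) (hist : IsOfIsotropicType F)
    {A B : C} {α : A ⟶ B} (hα : IsPreStep F α) : IsIso α ↔ IsIsometry F α :=
  ⟨fun _ => isIsometry_of_isIso F hP α, fun h => hist A α h hα⟩

/-- In a Frobenioid every `1 ≠ x ∈ Φ(A)` is the zero divisor of a step `A → B` (a co-angular
pre-step with zero divisor `x`, Def. 1.3 (iii)(d); it is not an isomorphism by Remark 1.1.1). [cite: MochizukiFrdI2008, Def. 1.3(iii) p.24] -/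
theorem exists_step_of_ne_one (hF : IsFrobenioid F) {A : C} {x : Φ.obj (op (baseObj F A))}
    (hx : x ≠ 1) :
    ∃ (B : C) (α : A ⟶ B), IsStep F α ∧ Div F α = x := by
  obtain ⟨B, α, hα, hαx⟩ := hF.iii_d_under_surj A x
  refine ⟨B, α, ⟨hα.2, fun hi => hx ?_⟩, hαx⟩
  rw [← hαx]
  exact isIsometry_of_isIso F hF.isPreFrobenioid α

/-! ### Proposition 1.14 (v), necessity -/

/-- **Prop. 1.14 (v)**, necessity: if `φ` is a `Div`-identity prime-Frobenius endomorphism of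
`A`, then for every step `α : A → B` there are a non-pre-step irreducible `ψ : B → B′` (a
prime-Frobenius morphism of the same degree) and a step `β : B → B′` with `ψ ∘ α = β ∘ α ∘ φ`
(Prop. 1.10 (i); Def. 1.3 (ii), (iii)(d)). [cite: MochizukiFrdI2008, Prop. 1.14(v) p.43] -/
theorem exists_square_of_isDivIdentity_isPrimeFrobenius (hF : IsFrobenioid F)
    (hist : IsOfIsotropicType F) {A : C} {φ : A ⟶ A} (hdi : IsDivIdentity F φ)
    (hpf : IsPrimeFrobenius F φ) {B : C} (α : A ⟶ B) (hα : IsStep F α) :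
    ∃ (B' : C) (ψ β : B ⟶ B'), (IsIrreducibleHom ψ ∧ ¬ IsPreStep F ψ) ∧ IsStep F β ∧
      α ≫ ψ = φ ≫ α ≫ β := by
  have hP : IsPreFrobenioid Φ F := hF.isPreFrobenioid
  -- a prime-Frobenius `ψ : B → B'` of the same degree as `φ`
  obtain ⟨B', ψ, hψ, hψd⟩ := hF.ii_exists B (degFr F φ)
  have hψpf : IsPrimeFrobenius F ψ := ⟨hψ, by rw [hψd]; exact hpf.2⟩
  have hψnps : ¬ IsPreStep F ψ := fun h => by
    have h1 := hψpf.2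
    rw [show degFr F ψ = 1 from h.1, PNat.one_coe] at h1
    exact Nat.not_prime_one h1
  -- the Frobenius conjugate `α' : A → B'` of `α`: a pre-step with `Div(α') = Div(α) ^ deg(φ)`
  obtain ⟨α', -, hsq⟩ := exists_frobeniusConjugate hF α hpf.1 hψ hψd.symm
  have hα' : IsPreStep F α' := hα.1.frobeniusConjugate hF hsq hpf.1 hψ hψd.symm
  haveI : IsIso (Base F φ) := hpf.1.2
  have hinv : ∀ x, pull Φ (inv (Base F φ)) x = x := fun x => by
    conv_lhs => rw [show x = pull Φ (Base F φ) x from (DFunLike.congr_fun hdi x).symm]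
    rw [← pull_comp, IsIso.inv_hom_id, pull_id]
  have hdiv : Div F α' = Div F α ^ (degFr F φ : ℕ) := by
    rw [div_frobeniusConjugate hsq hpf.1 hψ, hinv, hψd]
  -- the step `β : B → B'` with `β ∘ α = α'`
  obtain ⟨β, hβ, hαβ⟩ := hF.iii_d_under_full α α'
    ⟨isCoAngular_of_isOfIsotropicType F hist α, hα.1⟩
    ⟨isCoAngular_of_isOfIsotropicType F hist α', hα'⟩
    (by rw [hdiv]; exact dvd_pow_self _ (PNat.ne_zero _))
  have hβstep : IsStep F β := by
    refine ⟨hβ.2, fun hβi => hα.2 ?_⟩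
    -- if `β` were an isomorphism, `Div(α) ^ p = Div(α)`, so `Div(α) = 0` and `α` is an isomorphism
    rw [isIso_iff_isIsometry_of_isPreStep F hP hist hα.1]
    have h1 : Div F α ^ (degFr F φ : ℕ) = Div F α := by
      rw [← hdiv, ← hαβ, div_comp, show Div F β = 1 from isIsometry_of_isIso F hP β, map_one,
        one_mul, show degFr F β = 1 from hβ.2.1, PNat.one_coe, pow_one]
    haveI : IsCancelMul (Φ.obj (op (baseObj F A))) :=
      isIntegral_iff_isCancelMul.mp (hP.isDivisorial (baseObj F A)).isPreDivisorial.isIntegral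
    have h2 : Div F α ^ ((degFr F φ : ℕ) - 1) = 1 := by
      have h3 : Div F α ^ ((degFr F φ : ℕ) - 1) * Div F α = 1 * Div F α := by
        rw [← pow_succ, Nat.sub_add_cancel (PNat.pos _), h1, one_mul]
      exact mul_right_cancel h3
    exact (hP.isDivisorial (baseObj F A)).isSharp.isTorsionFree.eq_one_of_pow_eq_one _ _
      (Nat.sub_pos_of_lt (Nat.Prime.one_lt hpf.2)) h2
  exact ⟨B', ψ, β, ⟨hψpf.isIrreducibleHom hF (hist B), hψnps⟩, hβstep, by rw [hαβ]; exact hsq.symm⟩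

/-! ### Proposition 1.14 (v), sufficiency -/

/-- The divisor identity behind the sufficiency proof (Remark 1.1.1): for an isometric
endomorphism `φ` of `A`, a step `α : A → B` and `ψ, β : B → B′` with `β` a pre-step and
`ψ ∘ α = β ∘ α ∘ φ`, one has `α^*(Div ψ) + deg(ψ) · Div(α) = φ^*(α^*(Div β) + Div(α))`.
[cite: MochizukiFrdI2008, Prop. 1.14(v) p.43] -/
theorem div_eq_of_square {A B B' : C} {φ : A ⟶ A} {α : A ⟶ B} {ψ β : B ⟶ B'}
    (hφ : IsIsometry F φ) (hβ : IsLinear F β) (h : α ≫ ψ = φ ≫ α ≫ β) :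
    pull Φ (Base F α) (Div F ψ) * Div F α ^ (degFr F ψ : ℕ) =
      pull Φ (Base F φ) (pull Φ (Base F α) (Div F β) * Div F α) := by
  have h1 := congrArg (Div F) h
  rwa [div_comp, div_comp, div_comp, show Div F φ = 1 from hφ, one_pow, mul_one,
    show degFr F β = 1 from hβ, PNat.one_coe, pow_one] at h1

/-- **Prop. 1.14 (v)**, sufficiency: let `Φ` be non-dilating and `φ` a non-pre-step irreducible
endomorphism of a non-group-like `A` such that every step `α : A → B` admits a non-pre-step
irreducible `ψ : B → B′` and a step `β : B → B′` with `ψ ∘ α = β ∘ α ∘ φ`; then `φ` is a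
`Div`-identity prime-Frobenius endomorphism. [cite: MochizukiFrdI2008, Prop. 1.14(v) p.43] -/
theorem isDivIdentity_isPrimeFrobenius_of_squares (hF : IsFrobenioid F)
    (hist : IsOfIsotropicType F) (hnd : IsNonDilatingOn Φ) {A : C} {φ : A ⟶ A}
    (hnps : ¬ IsPreStep F φ) (hirr : IsIrreducibleHom φ) (hng : ¬ IsGroupLikeObj F A)
    (hcond : ∀ ⦃B : C⦄ (α : A ⟶ B), IsStep F α →
      ∃ (B' : C) (ψ β : B ⟶ B'), (IsIrreducibleHom ψ ∧ ¬ IsPreStep F ψ) ∧ IsStep F β ∧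
        α ≫ ψ = φ ≫ α ≫ β) :
    IsDivIdentity F φ ∧ IsPrimeFrobenius F φ := by
  have hP : IsPreFrobenioid Φ F := hF.isPreFrobenioid
  haveI : IsCancelMul (Φ.obj (op (baseObj F A))) :=
    isIntegral_iff_isCancelMul.mp (hP.isDivisorial (baseObj F A)).isPreDivisorial.isIntegral
  have hinj : Function.Injective (pull Φ (Base F φ)) := (hP.isMonoidOn.isCharInjective _).1
  -- for `x ≠ 0`: a step `α` with `Div(α) = x`, the square `ψ ∘ α = β ∘ α ∘ φ`, `y = α^* Div(β) ≠ 0`,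
  -- the type of `ψ` matches that of `φ` [(iv)], and the divisor identity
  have key : ∀ x : Φ.obj (op (baseObj F A)), x ≠ 1 → IsIsometry F φ →
      ∃ (B B' : C) (α : A ⟶ B) (ψ : B ⟶ B') (y : Φ.obj (op (baseObj F A))), y ≠ 1 ∧
        IsIrreducibleHom ψ ∧ ¬ IsPreStep F ψ ∧
        ((IsPrimeFrobenius F ψ ↔ IsPrimeFrobenius F φ) ∧ degFr F ψ = degFr F φ) ∧
        pull Φ (Base F α) (Div F ψ) * x ^ (degFr F ψ : ℕ) =
          pull Φ (Base F φ) y * pull Φ (Base F φ) x := by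
    intro x hx hφi
    obtain ⟨B, α, hα, hαx⟩ := exists_step_of_ne_one F hF hx
    obtain ⟨B', ψ, β, ⟨hψirr, hψnps⟩, hβ, hsq⟩ := hcond α hα
    have hy : pull Φ (Base F α) (Div F β) ≠ 1 := fun h => hβ.2 (by
      rw [isIso_iff_isIsometry_of_isPreStep F hP hist hβ.1]
      exact (hP.isMonoidOn.isCharInjective _).1 (by rw [h, map_one]))
    have hiv := isPrimeFrobenius_iff_of_square F hF hist hsq
      (by rw [degFr_comp, show degFr F α = 1 from hα.1.1, show degFr F β = 1 from hβ.1.1,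
        mul_one]) hψirr hirr
    refine ⟨B, B', α, ψ, _, hy, hψirr, hψnps, hiv, ?_⟩
    rw [← map_mul, ← hαx]
    exact div_eq_of_square F hφi hβ.1.1 hsq
  -- a nonzero element of `Φ(A)` (`A` is non-group-like)
  obtain ⟨x₀, hx₀⟩ : ∃ x : Φ.obj (op (baseObj F A)), x ≠ 1 := by
    by_contra h
    exact hng (fun x => by by_contra hx; exact h ⟨x, hx⟩)
  -- Step 1: `φ` is not a pull-back morphism, hence [by (i)] a prime-Frobenius morphism
  have hpf : IsPrimeFrobenius F φ := by
    rcases trichotomy_of_isIrreducibleHom F hF hist hirr with ha | ⟨hb, -⟩ | ⟨hc, -⟩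
    · exact ha
    · exact (hnps hb.1).elim
    · exfalso
      have hφi : IsIsometry F φ := (hF.iv_b φ hc).1.2
      have hφlin : IsLinear F φ := (hF.iv_b φ hc).2
      have hφnpf : ¬ IsPrimeFrobenius F φ := fun h => by
        have h1 := h.2
        rw [show degFr F φ = 1 from hφlin, PNat.one_coe] at h1
        exact Nat.not_prime_one h1
      -- `φ^*(x) ≤ x` for all `x`, hence `φ^* = id` by non-dilation
      have hle : ∀ x, pull Φ (Base F φ) x ∣ x := by
        intro x
        by_cases hx : x = 1
        · rw [hx, map_one]
        obtain ⟨B, B', α, ψ, y, -, hψirr, hψnps, ⟨hiff, -⟩, heq⟩ := key x hx hφi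
        -- `ψ` is a pull-back morphism as well [(i), (iv)], hence a linear isometry
        have hψpb : IsPullbackMorphism F ψ := by
          rcases trichotomy_of_isIrreducibleHom F hF hist hψirr with h1 | ⟨h2, -⟩ | ⟨h3, -⟩
          · exact (hφnpf (hiff.mp h1)).elim
          · exact (hψnps h2.1).elim
          · exact h3
        rw [show Div F ψ = 1 from (hF.iv_b ψ hψpb).1.2, map_one, one_mul,
          show degFr F ψ = 1 from (hF.iv_b ψ hψpb).2, PNat.one_coe, pow_one] at heq
        exact ⟨_, by rw [mul_comm]; exact heq⟩
      have hid := pull_eq_id_of_precsim F hP hnd (Base F φ) (fun x => Precsim.of_dvd (hle x))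
      -- but then `y = 0` for the square attached to `x₀`
      obtain ⟨B, B', α, ψ, y, hy, hψirr, hψnps, ⟨hiff, -⟩, heq⟩ := key x₀ hx₀ hφi
      have hψpb : IsPullbackMorphism F ψ := by
        rcases trichotomy_of_isIrreducibleHom F hF hist hψirr with h1 | ⟨h2, -⟩ | ⟨h3, -⟩
        · exact (hφnpf (hiff.mp h1)).elim
        · exact (hψnps h2.1).elim
        · exact h3
      rw [show Div F ψ = 1 from (hF.iv_b ψ hψpb).1.2, map_one, one_mul,
        show degFr F ψ = 1 from (hF.iv_b ψ hψpb).2, PNat.one_coe, pow_one, hid,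
        MonoidHom.id_apply, MonoidHom.id_apply] at heq
      exact hy (mul_right_cancel (heq.symm.trans (one_mul x₀).symm))
  -- Step 2: `φ^*(x) ≼ x` for all `x`, hence `φ^* = id`: `φ` is a `Div`-identity
  have hφi : IsIsometry F φ := hpf.1.1.2
  refine ⟨pull_eq_id_of_precsim F hP hnd (Base F φ) (fun x => ?_), hpf⟩
  by_cases hx : x = 1
  · rw [hx, map_one]
    exact precsim_refl 1
  obtain ⟨B, B', α, ψ, y, -, -, -, ⟨hiff, hdeg⟩, heq⟩ := key x hx hφi
  have hψi : IsIsometry F ψ := (hiff.mpr hpf).1.1.2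
  rw [show Div F ψ = 1 from hψi, map_one, one_mul, hdeg] at heq
  exact ⟨degFr F φ, PNat.pos _, ⟨_, by rw [mul_comm]; exact heq⟩⟩

/-- **Prop. 1.14 (v)**: for `Φ` non-dilating and `φ` a non-pre-step irreducible endomorphism of a
non-group-like `A` in a Frobenioid of isotropic type, "`φ` is a `Div`-identity prime-Frobenius
endomorphism if and only if … for every step `α : A → B`, there exists a non-pre-step
irreducible morphism `ψ : B → B′` and a step `β : B → B′` such that `ψ ∘ α = β ∘ α ∘ φ`."
[cite: MochizukiFrdI2008, Prop. 1.14(v) p.41] -/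
theorem isDivIdentity_isPrimeFrobenius_iff (hF : IsFrobenioid F) (hist : IsOfIsotropicType F)
    (hnd : IsNonDilatingOn Φ) {A : C} {φ : A ⟶ A} (hnps : ¬ IsPreStep F φ)
    (hirr : IsIrreducibleHom φ) (hng : ¬ IsGroupLikeObj F A) :
    IsDivIdentity F φ ∧ IsPrimeFrobenius F φ ↔
      ∀ ⦃B : C⦄ (α : A ⟶ B), IsStep F α →
        ∃ (B' : C) (ψ β : B ⟶ B'), (IsIrreducibleHom ψ ∧ ¬ IsPreStep F ψ) ∧ IsStep F β ∧
          α ≫ ψ = φ ≫ α ≫ β :=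
  ⟨fun h _ α hα => exists_square_of_isDivIdentity_isPrimeFrobenius F hF hist h.1 h.2 α hα,
    fun h => isDivIdentity_isPrimeFrobenius_of_squares F hF hist hnd hnps hirr hng h⟩

end PreFrobenioid

end Literature.AlgebraicGeometry.Frobenioids
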